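/-
Copyright: cell `pub-ymgap` (HUMAN RULING D-0062), Track A of `YM-PLAN.md`, DAG node N20 (= NE7b); R134 acceleration seat
`pub-ymgap-dag-n20-c` (strategy s1, generation 4), module 18.  Released under the licence of the surrounding project.
-/
import Summits.QuantumFields.YangMills.Theorems.BalabanUVNodesN20LCSLargeFieldLabels
import Summits.QuantumFields.YangMills.Theorems.BalabanUVNodesN20LCSAvgExpMoment
import HarnessLib

/-!
# YM-DAG node N20 (= NE7b), strategy s1, module 18: THE FIRST 𝐑𝐓 STEP OF RECORD PINS A (3.2) LARGE-FIELD CUBE WITH EXPONENTIALLY SMALL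
# RELATIVE WEIGHT — «hrel» at `j = 0` for the pinned large-field LABELS of Bałaban's step weights of record, modulo two displayed letters

Track A of `YM-PLAN.md` (cell `pub-ymgap`, HUMAN RULING D-0062), node **N20** = spine estimate NE7b (`T4WeightBudget.RelWeightBound` — NOT PRINTED,
NOT PROVED).  Seat `pub-ymgap-dag-n20-c` (R134, s1), generation 4, module 18 (module 17 = `…N20LCSLargeFieldLabels`: the label algebra).  Kernel
theorems only: 0 `def`, 0 `sorry`, standard axioms; COUNT-NEUTRAL; `--supports` the K3′ item.  Nothing of Bałaban's is asserted.

WHAT.  The (α)-road (`Spine/NE7b/LocalConditionalStability.hrel_of_LCS`) needs, per pinned step, the ONE-STEP RELATIVE DISPLAY «hrel»: the mass of the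
pinned continuations of a history term is at most `e^{b−a}` times the term's mass.  Module 17 reduced the pinned (3.2) labels of NODE 00's step weights
of record to the complement factor `1 − χ_{k+1}(c)(V′)` pointwise.  Here:
* §1 **`one_sub_chiFactor_le_indicator`**: under the REGULARITY LETTER of the cube `c` — «new field `ε″`-small on `R` ⇒ `χ_{k+1}(c) = 1`», the
  content of [Balaban1985PropagatorsII] Thm 1 at def-R's (2.16) local problem on `c^{∼4}` (small data ⇒ the local minimal configuration is
  `ε_{k+1}η²`-regular on `{p ⊂ c^∼}`; off the solvable set the factor is `1` by the typing convention, n20-d's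
  `N20ChiSemantics.chiSmall_ukBox_eq_one_of_not_solvable`), DISPLAYED as a hypothesis (`hreg`, like n20-d's `hsolv`) —
  `1 − χ_{k+1}(c)(V′) ≤ 𝟙[∃ p′ ∈ R, ε″ ≤ |V′(∂p′) − 1|]`; hence (`abs_sum_ωOfRecord_filter_fst_le_indicator`) the pinned (3.2) labels live on a COARSE
  LARGE-FIELD EVENT of the new field near `c`;
* §2 ON THE GRAPH `V′ = Ū` (the fine-level form to which module 3's `N20LCSAtTStepOfRecord.integral_mul_piece_texpASucc` reduces every statement about
  the pieces of NODE 00's T-step): **`abs_integral_sum_ωOfRecord_filter_fst_mul_le`** — against ANY integrable old piece `f ≥ 0` at ANY step `k`,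
  `|∫ (Σ_{t : c ∈ P(t)} ω s t (U,Ū))·f dU| ≤ ∫_{∃ p′∈R, ε″ ≤ |Ū(∂p′)−1|} f dU` — «hrel» for the pinned (3.2) event REDUCED to coarse large-field sparseness
  of the averaged field IN THE TERM's OWN STATE `f` (for `k ≥ 1` that sparseness is the content of «LCS-j»; n20-d's transfer rule
  `N20LCSAvgTransfer.measureReal_largeField_avgFun_le_of_moments` converts a moment bound in the state `f` into it); `setIntegral_exists_le_sum`
  (union bound);
* §3 THE FIRST STEP (`k = 0`, state `ρ₀ = rhoZeroOfRecord`, `χ_0 ≡ 1`): **`setIntegral_rhoZeroOfRecord`** (`∫_S ρ₀ = gibbs(S)·∫ρ₀`) and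
  ★★ **`abs_integral_pinnedLargeLabels_rhoZero_le`** — with the `δ₀ > 0`, `C ≥ 0` of n20-d's `N20LCSAvgExpMoment.gibbsMeasure_largeField_dist1_avgFun_le`
  (functions of `N`, `L` only), on every torus `F.P K` (`K ≥ 1`), for `g₀⁻² ≥ 4N`:
  `|∫ (Σ_{t : c ∈ P(t)} ω s t (U,Ū)) ρ₀ dU| ≤ #R · e^{Cδ₀} · e^{−δ₀·g₀⁻²·ε″²∕(2N)} · ∫ ρ₀ dU`
  — print's «we estimate the factors by exp(−p₀(g_j))» ([Balaban1989LargeFieldII] p. 383; [Balaban1989LargeFieldI] (0.1) p. 175) for the (3.2) factors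
  of [Balaban1988Convergent] p. 265 AT THE STEP WEIGHTS OF RECORD, first step, `β = g₀⁻²`-explicit: the extracted exponent is `a = δ₀·g₀⁻²·ε″²∕(2N)`
  against the volume constant `log #R + Cδ₀` (both halves of «LCS-0» for the pinned (3.2) LABEL event, composed).

HONEST FRAMING.  Conditional on two DISPLAYED letters — `IsZetaAbsLeOne` (size law of the residual fluctuation factor of record) and the regularity
letter `hreg` ([Balaban1985PropagatorsII] Thm 1, NOT asserted, NOT proved here) — and stated at the LABEL level (the tower's choice index is the
resummed sequence; the collar labels and the (3.3)∕inherited large fields are NOT extracted here: (3.12)–(3.19), the key-pattern READING of the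
(α)-road, RR-1 ∕ (A1c)).  Level `k ≥ 1` is REDUCED (§2), not proved («LCS-j»).  NE7b NOT PRINTED ∕ NOT PROVED; (α)-instance 0∕1; N20 NOT discharged;
typed 28∕28, discharged count untouched; one finite four-torus at fixed `ε` — NOT ℝ⁴, NOT infinite volume, NOT OS, NOT a mass gap, NOT Clay.

References: T. Bałaban, CMP 119 (1988) 243–285 [Balaban1988Convergent] ((3.2) p. 265, (2.16) p. 257); CMP 99 (1985) 389–434 [Balaban1985PropagatorsII]
(Thm 1); CMP 122 (1989) 175–202 [Balaban1989LargeFieldI] ((0.1) p. 175); CMP 122 (1989) 355–392 [Balaban1989LargeFieldII] (p. 383 l. 18–21);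
CMP 109 (1987) 249–301 [Balaban1987RG1] ((0.4) p. 253).
-/

set_option autoImplicit false

noncomputable section

open scoped BigOperators

namespace Summit.QuantumFields.YangMills.BalabanUVNodes.N20LCSLargeFieldFirstStep

open MeasureTheory
open Literature.MathematicalPhysics.QuantumFieldTheory.Balaban1983to89
open Literature.MathematicalPhysics.QuantumFieldTheory.Balaban1983to89.T4Continuum
open Literature.MathematicalPhysics.QuantumFieldTheory.Balaban1983to89.Node00
open Summit.QuantumFields.YangMills.BalabanUVNodes.N20LCSLargeFieldLabels (abs_sum_ωOfRecord_filter_fst_le)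

/-! ## §1 The regularity letter of a cube turns its complement factor into a coarse large-field indicator -/

section Letter

variable (F : T4Family) (N : ℕ) [NeZero N] (ν : Stage7Numerics) (M : ℕ) (p : B12.RunParams) (g : ℕ → ℝ) (k : ℕ)

/-- **THE COMPLEMENT FACTOR UNDER THE REGULARITY LETTER.**  Let `c` be a χ_{k+1}-cube, `R` a finite set of level-`(k+1)` plaquettes and `ε″`
a threshold such that the REGULARITY LETTER of `c` holds: whenever the new field `V′` is `ε″`-small on `R` (`|V′(∂p′) − 1| < ε″`, `p′ ∈ R`),
the (3.2) factor of `c` is `1` (`hreg` — in print the content of [Balaban1985PropagatorsII] Thm 1 at def-R's (2.16) local problem on `c^{∼4}`: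
small data ⇒ the local minimal configuration `U_{k+1,c}(V′)` exists and is `ε_{k+1}η²`-regular on `{p ⊂ c^∼}`; off the solvable set the factor
is `1` by the typing convention, `N20ChiSemantics.chiSmall_ukBox_eq_one_of_not_solvable`).  Then POINTWISE
`1 − χ_{k+1}(c)(V′) ≤ 𝟙[∃ p′ ∈ R, ε″ ≤ |V′(∂p′) − 1|]`. [folklore] -/
theorem one_sub_chiFactor_le_indicator (c : Iχ F ν p g k) (R : Finset (Plaq (F.P p.K) (k + 1))) (ε'' : ℝ)
    (hreg : ∀ V' : GaugeField (F.P p.K) (k + 1) (SU N),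
      (∀ p' ∈ R, dist1 (GaugeField.plaqHol V' p') < ε'') → chiFactor F N ν p g k c V' = 1)
    (V' : GaugeField (F.P p.K) (k + 1) (SU N)) :
    1 - chiFactor F N ν p g k c V' ≤
      Set.indicator {V' : GaugeField (F.P p.K) (k + 1) (SU N) | ∃ p' ∈ R, ε'' ≤ dist1 (GaugeField.plaqHol V' p')}
        (fun _ => (1 : ℝ)) V' := by
  by_cases h : ∀ p' ∈ R, dist1 (GaugeField.plaqHol V' p') < ε''
  · rw [hreg V' h, sub_self]
    exact Set.indicator_nonneg (fun _ _ => zero_le_one) V'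
  · push Not at h
    obtain ⟨p', hp', hle⟩ := h
    rw [Set.indicator_of_mem (show V' ∈ {V' : GaugeField (F.P p.K) (k + 1) (SU N) |
        ∃ p' ∈ R, ε'' ≤ dist1 (GaugeField.plaqHol V' p')} from ⟨p', hp', hle⟩)]
    exact sub_le_self _ (chiFactor_nonneg F N ν p g k c V')

/-- The union bound, pointwise: `𝟙[∃ p′ ∈ R, ε″ ≤ |V′(∂p′) − 1|] ≤ Σ_{p′∈R} 𝟙[ε″ ≤ |V′(∂p′) − 1|]`. [folklore] -/
theorem indicator_exists_le_sum (R : Finset (Plaq (F.P p.K) (k + 1))) (ε'' : ℝ) (V' : GaugeField (F.P p.K) (k + 1) (SU N)) :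
    Set.indicator {V' : GaugeField (F.P p.K) (k + 1) (SU N) | ∃ p' ∈ R, ε'' ≤ dist1 (GaugeField.plaqHol V' p')}
        (fun _ => (1 : ℝ)) V' ≤
      ∑ p' ∈ R, Set.indicator {V' : GaugeField (F.P p.K) (k + 1) (SU N) | ε'' ≤ dist1 (GaugeField.plaqHol V' p')}
        (fun _ => (1 : ℝ)) V' := by
  set T : Set (GaugeField (F.P p.K) (k + 1) (SU N)) :=
    {V' | ∃ p' ∈ R, ε'' ≤ dist1 (GaugeField.plaqHol V' p')} with hT
  set Tq : Plaq (F.P p.K) (k + 1) → Set (GaugeField (F.P p.K) (k + 1) (SU N)) :=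
    fun q => {V' | ε'' ≤ dist1 (GaugeField.plaqHol V' q)} with hTq
  have h0 : ∀ q, 0 ≤ Set.indicator (Tq q) (fun _ => (1 : ℝ)) V' := fun q => Set.indicator_nonneg (fun _ _ => zero_le_one) V'
  by_cases h : ∃ p' ∈ R, ε'' ≤ dist1 (GaugeField.plaqHol V' p')
  · obtain ⟨p', hp', hle⟩ := h
    rw [Set.indicator_of_mem (show V' ∈ T from ⟨p', hp', hle⟩)]
    calc (1 : ℝ) = Set.indicator (Tq p') (fun _ => (1 : ℝ)) V' := by rw [Set.indicator_of_mem (show V' ∈ Tq p' from hle)]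
      _ ≤ ∑ q ∈ R, Set.indicator (Tq q) (fun _ => (1 : ℝ)) V' :=
        Finset.single_le_sum (f := fun q => Set.indicator (Tq q) (fun _ => (1 : ℝ)) V') (fun q _ => h0 q) hp'
  · rw [Set.indicator_of_notMem (show V' ∉ T from h)]
    exact Finset.sum_nonneg fun q _ => h0 q

/-- **POINTWISE EXTRACTION OF THE PINNED (3.2) LABELS, READ THROUGH THE LETTER**: modulo `IsZetaAbsLeOne` and the regularity letter of `c`,
`|Σ_{t : c ∈ P(t)} ω s t (U,V′)| ≤ 𝟙[∃ p′ ∈ R, ε″ ≤ |V′(∂p′) − 1|]` — the pinned large-field labels live on a COARSE LARGE-FIELD EVENT of the new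
field near `c`. [folklore] -/
theorem abs_sum_ωOfRecord_filter_fst_le_indicator (A₁ : ℝ) {ζ : ZetaOfRecord F N ν M} (hζ : IsZetaAbsLeOne F N ν M ζ)
    (s : SeqOfRecord F ν M g p.K k) (c : Iχ F ν p g k) (R : Finset (Plaq (F.P p.K) (k + 1))) (ε'' : ℝ)
    (hreg : ∀ V' : GaugeField (F.P p.K) (k + 1) (SU N),
      (∀ p' ∈ R, dist1 (GaugeField.plaqHol V' p') < ε'') → chiFactor F N ν p g k c V' = 1)
    (U : GaugeField (F.P p.K) k (SU N)) (V' : GaugeField (F.P p.K) (k + 1) (SU N)) :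
    |∑ t ∈ Finset.univ.filter (fun t : LbOfRecord F ν p g k => c ∈ t.1), ωOfRecord F N ν M p g k A₁ ζ s t U V'| ≤
      Set.indicator {V' : GaugeField (F.P p.K) (k + 1) (SU N) | ∃ p' ∈ R, ε'' ≤ dist1 (GaugeField.plaqHol V' p')}
        (fun _ => (1 : ℝ)) V' :=
  (abs_sum_ωOfRecord_filter_fst_le F N ν M p g k A₁ hζ s c U V').trans
    (one_sub_chiFactor_le_indicator F N ν p g k c R ε'' hreg V')

/-- The coarse large-field events are measurable. [folklore] -/
theorem measurableSet_largeField (ε'' : ℝ) (p' : Plaq (F.P p.K) (k + 1)) :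
    MeasurableSet {V' : GaugeField (F.P p.K) (k + 1) (SU N) | ε'' ≤ dist1 (GaugeField.plaqHol V' p')} :=
  measurableSet_le measurable_const (RegularGaugeGroup.measurable_dist1.comp (Missing.measurable_plaqHol p'))

/-- The union event is measurable. [folklore] -/
theorem measurableSet_exists_largeField (R : Finset (Plaq (F.P p.K) (k + 1))) (ε'' : ℝ) :
    MeasurableSet {V' : GaugeField (F.P p.K) (k + 1) (SU N) | ∃ p' ∈ R, ε'' ≤ dist1 (GaugeField.plaqHol V' p')} := by
  have : {V' : GaugeField (F.P p.K) (k + 1) (SU N) | ∃ p' ∈ R, ε'' ≤ dist1 (GaugeField.plaqHol V' p')} =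
      ⋃ p' ∈ R, {V' : GaugeField (F.P p.K) (k + 1) (SU N) | ε'' ≤ dist1 (GaugeField.plaqHol V' p')} := by
    ext V'; simp
  rw [this]
  exact Finset.measurableSet_biUnion R fun p' _ => measurableSet_largeField F N p k ε'' p'

end Letter

/-! ## §2 On the graph `V′ = Ū`: the pinned (3.2) labels against a non-negative old piece -/

section Graph

variable (F : T4Family) (N : ℕ) [NeZero N] (ν : Stage7Numerics) (M : ℕ) (p : B12.RunParams) (g : ℕ → ℝ) (k : ℕ)

/-- **THE PINNED (3.2) LABELS AGAINST ANY NON-NEGATIVE OLD PIECE, ON THE GRAPH `V′ = Ū`** (the fine-level form to which module 3's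
`N20LCSAtTStepOfRecord.integral_mul_piece_texpASucc` reduces every statement about the pieces of NODE 00's T-step): for an integrable `f ≥ 0`
on the level-`k` fields (the history term's pinned fine density), modulo `IsZetaAbsLeOne` and the regularity letter of `c`,
`|∫ (Σ_{t : c ∈ P(t)} ω s t (U, Ū)) · f(U) dU| ≤ ∫_{∃ p′ ∈ R, ε″ ≤ |Ū(∂p′) − 1|} f(U) dU` — the relative weight of the labels pinning `c` LARGE is at
most the `f`-mass of a coarse large-field event of the averaged field near `c`: «hrel» for the pinned (3.2) event REDUCED to coarse large-field
sparseness of `Ū` in the term's own state (for `k ≥ 1` the content of «LCS-j»; `N20LCSAvgTransfer.measureReal_largeField_avgFun_le_of_moments`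
converts a moment bound in the state `f` into it). [folklore] -/
theorem abs_integral_sum_ωOfRecord_filter_fst_mul_le (A₁ : ℝ) {ζ : ZetaOfRecord F N ν M} (hζ : IsZetaAbsLeOne F N ν M ζ)
    (s : SeqOfRecord F ν M g p.K k) (c : Iχ F ν p g k) (R : Finset (Plaq (F.P p.K) (k + 1))) (ε'' : ℝ)
    (hreg : ∀ V' : GaugeField (F.P p.K) (k + 1) (SU N),
      (∀ p' ∈ R, dist1 (GaugeField.plaqHol V' p') < ε'') → chiFactor F N ν p g k c V' = 1)
    {f : GaugeField (F.P p.K) k (SU N) → ℝ} (hf0 : ∀ U, 0 ≤ f U) (hf : Integrable f (fieldMeasure (F.P p.K) k (SU N))) :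
    |∫ U, (∑ t ∈ Finset.univ.filter (fun t : LbOfRecord F ν p g k => c ∈ t.1),
        ωOfRecord F N ν M p g k A₁ ζ s t U ((avOfRecord F N p.K k).avg U)) * f U ∂(fieldMeasure (F.P p.K) k (SU N))| ≤
      ∫ U in {U | ∃ p' ∈ R, ε'' ≤ dist1 (GaugeField.plaqHol ((avOfRecord F N p.K k).avg U) p')}, f U
        ∂(fieldMeasure (F.P p.K) k (SU N)) := by
  set S : Set (GaugeField (F.P p.K) k (SU N)) :=
    {U | ∃ p' ∈ R, ε'' ≤ dist1 (GaugeField.plaqHol ((avOfRecord F N p.K k).avg U) p')} with hS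
  have hSm : MeasurableSet S :=
    (measurableSet_exists_largeField F N p k R ε'').preimage (avOfRecord_measurable F N p.K k)
  rw [← integral_indicator hSm, ← Real.norm_eq_abs]
  refine norm_integral_le_of_norm_le (hf.indicator hSm) (ae_of_all _ fun U => ?_)
  rw [Real.norm_eq_abs, abs_mul, abs_of_nonneg (hf0 U)]
  set T : Set (GaugeField (F.P p.K) (k + 1) (SU N)) :=
    {V' | ∃ p' ∈ R, ε'' ≤ dist1 (GaugeField.plaqHol V' p')} with hT
  have hind : Set.indicator S f U = Set.indicator T (fun _ => (1 : ℝ)) ((avOfRecord F N p.K k).avg U) * f U := by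
    by_cases hU : U ∈ S
    · rw [Set.indicator_of_mem hU, Set.indicator_of_mem (show (avOfRecord F N p.K k).avg U ∈ T from hU), one_mul]
    · rw [Set.indicator_of_notMem hU, Set.indicator_of_notMem (show (avOfRecord F N p.K k).avg U ∉ T from hU), zero_mul]
  rw [hind]
  exact mul_le_mul_of_nonneg_right
    (abs_sum_ωOfRecord_filter_fst_le_indicator F N ν M p g k A₁ hζ s c R ε'' hreg U _) (hf0 U)

/-- The `f`-mass of the union event is at most the sum of the `f`-masses (`f ≥ 0` integrable). [folklore] -/
theorem setIntegral_exists_le_sum {f : GaugeField (F.P p.K) k (SU N) → ℝ} (hf0 : ∀ U, 0 ≤ f U)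
    (hf : Integrable f (fieldMeasure (F.P p.K) k (SU N))) (avg : GaugeField (F.P p.K) k (SU N) → GaugeField (F.P p.K) (k + 1) (SU N))
    (havg : Measurable avg) (R : Finset (Plaq (F.P p.K) (k + 1))) (ε'' : ℝ) :
    ∫ U in {U | ∃ p' ∈ R, ε'' ≤ dist1 (GaugeField.plaqHol (avg U) p')}, f U ∂(fieldMeasure (F.P p.K) k (SU N)) ≤
      ∑ p' ∈ R, ∫ U in {U | ε'' ≤ dist1 (GaugeField.plaqHol (avg U) p')}, f U ∂(fieldMeasure (F.P p.K) k (SU N)) := by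
  set S : Set (GaugeField (F.P p.K) k (SU N)) := {U | ∃ p' ∈ R, ε'' ≤ dist1 (GaugeField.plaqHol (avg U) p')} with hS
  set Sq : Plaq (F.P p.K) (k + 1) → Set (GaugeField (F.P p.K) k (SU N)) :=
    fun q => {U | ε'' ≤ dist1 (GaugeField.plaqHol (avg U) q)} with hSq
  set T : Set (GaugeField (F.P p.K) (k + 1) (SU N)) :=
    {V' | ∃ p' ∈ R, ε'' ≤ dist1 (GaugeField.plaqHol V' p')} with hT
  set Tq : Plaq (F.P p.K) (k + 1) → Set (GaugeField (F.P p.K) (k + 1) (SU N)) :=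
    fun q => {V' | ε'' ≤ dist1 (GaugeField.plaqHol V' q)} with hTq
  have hSm : ∀ q : Plaq (F.P p.K) (k + 1), MeasurableSet (Sq q) := fun q =>
    (measurableSet_largeField F N p k ε'' q).preimage havg
  have hUm : MeasurableSet S := (measurableSet_exists_largeField F N p k R ε'').preimage havg
  -- the indicators of the fine events are the indicators of the coarse events on the graph
  have hq : ∀ q U, Set.indicator (Sq q) f U = Set.indicator (Tq q) (fun _ => (1 : ℝ)) (avg U) * f U := by
    intro q U
    by_cases hU : U ∈ Sq q
    · rw [Set.indicator_of_mem hU, Set.indicator_of_mem (show avg U ∈ Tq q from hU), one_mul]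
    · rw [Set.indicator_of_notMem hU, Set.indicator_of_notMem (show avg U ∉ Tq q from hU), zero_mul]
  have hu : ∀ U, Set.indicator S f U = Set.indicator T (fun _ => (1 : ℝ)) (avg U) * f U := by
    intro U
    by_cases hU : U ∈ S
    · rw [Set.indicator_of_mem hU, Set.indicator_of_mem (show avg U ∈ T from hU), one_mul]
    · rw [Set.indicator_of_notMem hU, Set.indicator_of_notMem (show avg U ∉ T from hU), zero_mul]
  show ∫ U in S, f U ∂(fieldMeasure (F.P p.K) k (SU N)) ≤ ∑ q ∈ R, ∫ U in Sq q, f U ∂(fieldMeasure (F.P p.K) k (SU N))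
  rw [← integral_indicator hUm]
  simp_rw [← integral_indicator (hSm _)]
  rw [← integral_finsetSum R fun q _ => hf.indicator (hSm q)]
  refine integral_mono (hf.indicator hUm) (integrable_finsetSum R fun q _ => hf.indicator (hSm q)) fun U => ?_
  show Set.indicator S f U ≤ ∑ q ∈ R, Set.indicator (Sq q) f U
  rw [hu U]
  simp_rw [hq _ U]
  rw [← Finset.sum_mul]
  exact mul_le_mul_of_nonneg_right (indicator_exists_le_sum F N p k R ε'' (avg U)) (hf0 U)

end Graph

/-! ## §3 THE FIRST 𝐑𝐓 STEP: the pinned (3.2) labels have relative weight `≤ #R·e^{Cδ₀}·e^{−δ₀g₀⁻²ε″²∕(2N)}` in `ρ₀`'s state -/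

section FirstStep

variable (F : T4Family) (N : ℕ) [NeZero N] (ν : Stage7Numerics) (M : ℕ) (p : B12.RunParams) (g : ℕ → ℝ)

/-- The `ρ₀`-mass of a measurable event is its Gibbs probability times the total mass: `∫_S ρ₀ = (gibbsMeasure (F.P K) g₀⁻²)(S) · ∫ ρ₀`
(`ρ₀ = e^{−E}·e^{−g₀⁻²A}`, `T4GenFunBounds.integral_gibbsMeasure`). [folklore] -/
theorem setIntegral_rhoZeroOfRecord (K : ℕ) (g₀ E : ℝ) {S : Set (cfgOfRecord F N K 0)} (hS : MeasurableSet S) :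
    ∫ U in S, rhoZeroOfRecord F N K g₀ E U ∂(fieldMeasure (F.P K) 0 (SU N)) =
      (T4GenFunBounds.gibbsMeasure (F.P K) (g₀⁻¹ ^ 2) : Measure (cfgOfRecord F N K 0)).real S *
        ∫ U, rhoZeroOfRecord F N K g₀ E U ∂(fieldMeasure (F.P K) 0 (SU N)) := by
  have hβ0 : (0 : ℝ) ≤ g₀⁻¹ ^ 2 := sq_nonneg _
  have hZ := Missing.partitionFn_pos' (G := SU N) (F.P K) hβ0
  have hreal : (T4GenFunBounds.gibbsMeasure (F.P K) (g₀⁻¹ ^ 2) : Measure (cfgOfRecord F N K 0)).real S *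
      Missing.partitionFn (G := SU N) (F.P K) (g₀⁻¹ ^ 2) =
        ∫ U in S, Missing.boltzmann (F.P K) (g₀⁻¹ ^ 2) U ∂(fieldMeasure (F.P K) 0 (SU N)) := by
    rw [← integral_indicator_one hS, T4GenFunBounds.integral_gibbsMeasure (F.P K) hβ0, div_mul_cancel₀ _ hZ.ne',
      ← integral_indicator hS]
    refine integral_congr_ae (ae_of_all _ fun U => ?_)
    show S.indicator 1 U * _ = S.indicator _ U
    by_cases hU : U ∈ S
    · simp only [Set.indicator_of_mem hU, Pi.one_apply, one_mul]
    · simp only [Set.indicator_of_notMem hU, zero_mul]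
  have hρ : rhoZeroOfRecord F N K g₀ E = fun U => Real.exp (-E) * Missing.boltzmann (F.P K) (g₀⁻¹ ^ 2) U := rfl
  rw [hρ, integral_const_mul, integral_const_mul, ← hreal, Missing.partitionFn]
  ring

/-- **THE FIRST 𝐑𝐓 STEP OF RECORD PINS A (3.2) LARGE-FIELD CUBE WITH EXPONENTIALLY SMALL RELATIVE WEIGHT** («hrel» at `j = 0` for the
pinned (3.2) labels, `β = g₀⁻²`-explicit).  With the `δ₀ > 0`, `C ≥ 0` of `N20LCSAvgExpMoment.gibbsMeasure_largeField_dist1_avgFun_le` (functions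
of `N` and `L = F.L` only): on every torus `F.P K` with `K ≥ 1`, for every bare coupling with `g₀⁻² ≥ 4N`, every normalisation `E`, every residual
fluctuation factor obeying `IsZetaAbsLeOne`, every `A₁`, every level-`0` sequence `s`, every χ₁-cube `c` whose regularity letter holds with
`(R, ε″)`, `ε″ ≥ 0`:
`|∫ (Σ_{t : c ∈ P(t)} ω s t (U, Ū)) ρ₀(U) dU| ≤ #R · e^{C·δ₀} · e^{−δ₀·g₀⁻²·(ε″²∕(2N))} · ∫ ρ₀(U) dU`
— the labels of the first step whose new large-field family contains `c` carry, in the initial density's own state, relative weight at most a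
union of `#R` Peierls factors of the once-averaged field (n20-d's `gibbsMeasure_largeField_dist1_avgFun_le` at `Y = {p′}`).  This is print's
«we estimate the factors by exp(−p₀(g_j))» ([Balaban1989LargeFieldII] p. 383) for the (3.2) factors of [Balaban1988Convergent] p. 265 AT THE STEP
WEIGHTS OF RECORD, first step, modulo the two displayed letters. [folklore] -/
theorem abs_integral_pinnedLargeLabels_rhoZero_le :
    ∃ δ₀ : ℝ, 0 < δ₀ ∧ ∃ C : ℝ, 0 ≤ C ∧ ∀ (hK : 1 ≤ p.K) (g₀ E : ℝ), 4 * N ≤ g₀⁻¹ ^ 2 →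
      ∀ (A₁ : ℝ) {ζ : ZetaOfRecord F N ν M}, IsZetaAbsLeOne F N ν M ζ →
      ∀ (s : SeqOfRecord F ν M g p.K 0) (c : Iχ F ν p g 0) (R : Finset (Plaq (F.P p.K) 1)) (ε'' : ℝ), 0 ≤ ε'' →
        (∀ V' : GaugeField (F.P p.K) 1 (SU N),
          (∀ p' ∈ R, dist1 (GaugeField.plaqHol V' p') < ε'') → chiFactor F N ν p g 0 c V' = 1) →
        |∫ U, (∑ t ∈ Finset.univ.filter (fun t : LbOfRecord F ν p g 0 => c ∈ t.1),
            ωOfRecord F N ν M p g 0 A₁ ζ s t U ((avOfRecord F N p.K 0).avg U)) * rhoZeroOfRecord F N p.K g₀ E U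
            ∂(fieldMeasure (F.P p.K) 0 (SU N))| ≤
          R.card * (Real.exp (C * δ₀) * Real.exp (-(δ₀ * g₀⁻¹ ^ 2 * (ε'' ^ 2 / (2 * (Fintype.card (Fin N) : ℝ)))))) *
            ∫ U, rhoZeroOfRecord F N p.K g₀ E U ∂(fieldMeasure (F.P p.K) 0 (SU N)) := by
  obtain ⟨δ₀, hδ₀, C, hC, h⟩ := N20LCSAvgExpMoment.gibbsMeasure_largeField_dist1_avgFun_le N F.L
  refine ⟨δ₀, hδ₀, C, hC, fun hK g₀ E hg A₁ ζ hζ s c R ε'' hε hreg => ?_⟩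
  have hβ0 : (0 : ℝ) ≤ g₀⁻¹ ^ 2 := sq_nonneg _
  haveI := T4GenFunBounds.isProbabilityMeasure_gibbsMeasure (G := SU N) (F.P p.K) hβ0
  set μ : Measure (cfgOfRecord F N p.K 0) := T4GenFunBounds.gibbsMeasure (F.P p.K) (g₀⁻¹ ^ 2) with hμ
  have hρ0 : ∀ U, 0 ≤ rhoZeroOfRecord F N p.K g₀ E U := fun U => (rhoZeroOfRecord_pos F N p.K g₀ E U).le
  have hρi : Integrable (rhoZeroOfRecord F N p.K g₀ E) (fieldMeasure (F.P p.K) 0 (SU N)) :=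
    (Missing.integrable_boltzmann RegularGaugeGroup.measurable_reTr (F.P p.K) hβ0).const_mul _
  have hI0 : 0 ≤ ∫ U, rhoZeroOfRecord F N p.K g₀ E U ∂(fieldMeasure (F.P p.K) 0 (SU N)) := integral_nonneg hρ0
  -- step 1: the label sum against ρ₀ is at most the ρ₀-mass of the coarse large-field event near `c`
  have h1 := abs_integral_sum_ωOfRecord_filter_fst_mul_le F N ν M p g 0 A₁ hζ s c R ε'' hreg hρ0 hρi
  -- step 2: union bound over `p′ ∈ R`
  have h2 := setIntegral_exists_le_sum F N p 0 hρ0 hρi (avOfRecord F N p.K 0).avg (avOfRecord_measurable F N p.K 0) R ε''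
  -- step 3: each event's ρ₀-mass is a Peierls factor times the total mass
  have h3 : ∀ p' ∈ R,
      ∫ U in {U | ε'' ≤ dist1 (GaugeField.plaqHol ((avOfRecord F N p.K 0).avg U) p')}, rhoZeroOfRecord F N p.K g₀ E U
          ∂(fieldMeasure (F.P p.K) 0 (SU N)) ≤
        (Real.exp (C * δ₀) * Real.exp (-(δ₀ * g₀⁻¹ ^ 2 * (ε'' ^ 2 / (2 * (Fintype.card (Fin N) : ℝ)))))) *
          ∫ U, rhoZeroOfRecord F N p.K g₀ E U ∂(fieldMeasure (F.P p.K) 0 (SU N)) := by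
    intro p' _
    have hSm : MeasurableSet {U : cfgOfRecord F N p.K 0 |
        ε'' ≤ dist1 (GaugeField.plaqHol ((avOfRecord F N p.K 0).avg U) p')} :=
      (measurableSet_largeField F N p 0 ε'' p').preimage (avOfRecord_measurable F N p.K 0)
    rw [setIntegral_rhoZeroOfRecord F N p.K g₀ E hSm]
    refine mul_le_mul_of_nonneg_right ?_ hI0
    have hsub : {U : cfgOfRecord F N p.K 0 | ε'' ≤ dist1 (GaugeField.plaqHol ((avOfRecord F N p.K 0).avg U) p')} ⊆
        {U : GaugeField (F.P p.K) 0 (Matrix.specialUnitaryGroup (Fin N) ℂ) |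
          ∀ q ∈ ({p'} : Finset (Plaq (F.P p.K) 1)),
            ε'' ≤ dist1 (GaugeField.plaqHol (BlockAveraging.avgFun (ExpMeanLog.expMeanLogSU (n := Fin N)) U) q)} := by
      intro U hU q hq
      rw [Finset.mem_singleton] at hq
      subst hq
      exact hU
    have hmK : 1 ≤ (F.P p.K).m + (F.P p.K).K := by
      simp only [T4Family.P_m, T4Family.P_K]; omega
    have hP := h (F.P p.K) (T4Family.P_d F p.K) (T4Family.P_L F p.K) hmK (g₀⁻¹ ^ 2) hg ε'' hε
      ({p'} : Finset (Plaq (F.P p.K) 1))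
    rw [Finset.card_singleton, Nat.cast_one, mul_one, mul_one] at hP
    exact (measureReal_mono hsub).trans hP
  -- assemble
  refine h1.trans (h2.trans ?_)
  calc ∑ p' ∈ R, ∫ U in {U | ε'' ≤ dist1 (GaugeField.plaqHol ((avOfRecord F N p.K 0).avg U) p')},
          rhoZeroOfRecord F N p.K g₀ E U ∂(fieldMeasure (F.P p.K) 0 (SU N))
      ≤ ∑ _p' ∈ R, (Real.exp (C * δ₀) * Real.exp (-(δ₀ * g₀⁻¹ ^ 2 * (ε'' ^ 2 / (2 * (Fintype.card (Fin N) : ℝ)))))) *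
          ∫ U, rhoZeroOfRecord F N p.K g₀ E U ∂(fieldMeasure (F.P p.K) 0 (SU N)) := Finset.sum_le_sum h3
    _ = R.card * (Real.exp (C * δ₀) * Real.exp (-(δ₀ * g₀⁻¹ ^ 2 * (ε'' ^ 2 / (2 * (Fintype.card (Fin N) : ℝ)))))) *
          ∫ U, rhoZeroOfRecord F N p.K g₀ E U ∂(fieldMeasure (F.P p.K) 0 (SU N)) := by
        rw [Finset.sum_const, nsmul_eq_mul]
        ring

end FirstStep

end Summit.QuantumFields.YangMills.BalabanUVNodes.N20LCSLargeFieldFirstStep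

end

/-! ### Erratum (g4, 2026-08-27) — citation pointer, prose only
In the prose of this file «[Balaban1985PropagatorsII] Thm 1» ∕ «CMP 99 (1985) 389–434» denotes T. Bałaban, *The variational problem and
background fields in renormalization group method for lattice gauge theories*, Commun. Math. Phys. **102** (1985) 277–309 — bib key
`Balaban1985Variational` —, Theorem 1 p. 279 (for data with `|∂V(p′) − 1| < ε₁ ≤ a₁` there is a minimal orbit in
`U_k({𝔅_j}, B₃ε₁) ∩ 𝔘_k(𝔅_k, V)`, the unique critical orbit for `B₃ε₁ ≤ ε₀ ≤ a₀`, with the local regularity (9)–(10)); there is no bib key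
`Balaban1985PropagatorsII`.  The regularity letter `hreg` is that theorem's shape at def-R's (2.16) problem.  Statements are unaffected. -/
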